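import Summits.ValiantsHypothesis.ValiantsHypothesis.Theorems.LacunarySymmetroidMatrixDescartesLagrangeTowerDefs

/-!
# `MatrixDescartes` census — the TWO-SIDED (mirror) Lagrange tower: definitions for the `K = 4` rung
# «ζ_sym(m,4) ≥ m² + 2m for every m» (the cell's P4)

HONEST FRAMING.  Object-search cell `pub-symmetroid`, crux `Theses.LacunarySymmetroid.MatrixDescartes`
(stmt-ValiantsHypothesis-18050); seat val-sym-mdr-p1 (g2).  DEFINITIONS ONLY (data, no claims), companion of `…LagrangeTowerDefs`
(arrowhead Lagrange tower, `KThreeColumnLaw`).  Objects of the kernel port of conjb-3 g4's two-sided tower P4 (ROUND4-MEMO §2: a second,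
DOWNWARD Lagrange flag on the same split base, flag letter at exponent `0`), in the seat's arrowhead form:
* `zwin w i` — the `i`-th point of window `w` (so `zroot k i = zwin k i`); `TowerData.GoodAt ρ d` — the split-frame identities with an
  arbitrary root vector `ρ` (`Good = GoodAt (zroot k)`);
* `Gen.*` — the bordering step with ARBITRARY child/parent root vectors `ν`, `z` and an orientation sign `s` (`s = 1`: parent roots
  below the child's, as in `step`; `s = −1`: parent roots above), `η = s^{k+1} (−1)^k θ`, `θ_new = s (−1)^k θ`;
* `mtower m k` — the MIRROR tower: level `k` has its `k` roots in window `2m − k` (BELOW window `m`), parent above child; its top level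
  `k = m` has the same roots `zroot m` as `tower m`;
* `congS / congC / congCinv` — the explicit congruence between the two top levels (`A₁ + xB₁ = Cᵀ (ε (A₂ + xB₂)) C`, `ε = θ₁ θ₂`), built
  from the frames only (no matrix inversion);
* the downward flag data (`sgnDn`, `thrDn`, letter `dnLetter`), the two-sided witness on support `(0, D, D+1, 2D+1)`, and the extended
  test-point walk (`dwalk`, `cpts`, `(m+1)²` points) with its limiting sign data `Ecomb`.
Nothing is asserted here; the companion proof files show `¬ PosRootLawAt m 4 (m² + 2m − 1)` for every `m ≥ 1`.  A LOWER-bound construction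
(CONJECTURE-A / census currency); nothing about the crux `MatrixDescartes` (upper bound at fat formats) or `VP ≠ VNP`.
[construction of the cell: conjb-3 g4 P4, re-routed]
-/

-- `Summit.ValiantsHypothesis.ValiantsHypothesis.…` repeats a component by the D-0017 layout
-- (single-conjunct summit), which the `dupNamespace` linter flags; the name is mandated.
set_option linter.dupNamespace false

noncomputable section

namespace Summit.ValiantsHypothesis.ValiantsHypothesis.Theorems.LacunarySymmetroidMatrixDescartes.Census.LagrangeTower

open Matrix Polynomial Finset
open scoped BigOperators

/-- The `i`-th point of window `w`: `4^{-w}·(1 + (i+1)/(w+1))` (`zroot k i = zwin k i`). [folklore] -/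
def zwin (w i : ℕ) : ℝ := ((4 : ℝ)⁻¹) ^ w * (1 + ((i : ℝ) + 1) / ((w : ℝ) + 1))

/-- Split-frame identities of a level with an ARBITRARY designed root vector `ρ`: `θ = ±1`, `Wᵀ U = 1`,
`Wᵀ (A + x B) W = diagonal (β_i (x − ρ_i))`, `0 < θ (−1)^i β_i`. [folklore] -/
def TowerData.GoodAt {k : ℕ} (ρ : Fin k → ℝ) (d : TowerData k) : Prop :=
  (d.θ = 1 ∨ d.θ = -1) ∧ d.Wᵀ * d.U = 1 ∧
    (∀ x : ℝ, d.Wᵀ * (d.A + x • d.B) * d.W = diagonal (fun i => d.β i * (x - ρ i))) ∧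
    ∀ i : Fin k, 0 < d.θ * (-1) ^ (i : ℕ) * d.β i

namespace Gen

/-! ## The bordering step with arbitrary root vectors and orientation -/

section Step

variable {k : ℕ} (ν : Fin k → ℝ) (z : Fin (k + 1) → ℝ) (s : ℝ) (d : TowerData k)

/-- `P = ∏_i (X − z_i)`. [folklore] -/
def Ppoly : ℝ[X] := ∏ i : Fin (k + 1), (X - C (z i))

/-- `N = ∏_l (X − ν_l)`. [folklore] -/
def Npoly : ℝ[X] := ∏ l : Fin k, (X - C (ν l))

/-- `N_l = ∏_{j ≠ l} (X − ν_j)`. [folklore] -/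
def Nlpoly (l : Fin k) : ℝ[X] := ∏ j ∈ univ.erase l, (X - C (ν j))

/-- `r_l = P(ν_l) / N_l(ν_l)`. [folklore] -/
def rcoef (l : Fin k) : ℝ := (Ppoly z).eval (ν l) / (Nlpoly ν l).eval (ν l)

/-- Linear part of `P/N` read at a non-root `w`. [folklore] -/
def lval (w : ℝ) : ℝ := ((Ppoly z).eval w - ∑ l, rcoef ν z l * (Nlpoly ν l).eval w) / (Npoly ν).eval w

/-- Slope of the linear part (auxiliary nodes `5, 6`). [folklore] -/
def lslope : ℝ := lval ν z 6 - lval ν z 5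

/-- Constant term of the linear part. [folklore] -/
def lconst : ℝ := lval ν z 5 - 5 * lslope ν z

/-- The linear part as a polynomial. [folklore] -/
def Lpoly : ℝ[X] := C (lconst ν z) + C (lslope ν z) * X

/-- Orientation of the new level: `η = s^{k+1} (−1)^k θ`. [folklore] -/
def ηnew : ℝ := s ^ (k + 1) * (-1) ^ k * d.θ

/-- New alternation sign: `θ_new = s (−1)^k θ`. [folklore] -/
def θnew : ℝ := s * (-1) ^ k * d.θ

/-- Arrow entries in the child's frame. [folklore] -/
def cvec (l : Fin k) : ℝ := Real.sqrt (-(ηnew s d * rcoef ν z l * d.β l))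

/-- Arrow entries in original coordinates. [folklore] -/
def bvec : Fin k → ℝ := d.U *ᵥ cvec ν z s d

/-- The secular function. [folklore] -/
def ψfun (x : ℝ) : ℝ := ηnew s d * (Lpoly ν z).eval x - ∑ l, (cvec ν z s d l) ^ 2 / d.β l / (x - ν l)

/-- Its derivative expression. [folklore] -/
def ψder (x : ℝ) : ℝ := ηnew s d * lslope ν z + ∑ l, (cvec ν z s d l) ^ 2 / d.β l / (x - ν l) ^ 2

/-- New sign characteristic. [folklore] -/
def βnew (i : Fin (k + 1)) : ℝ := ψder ν z s d (z i)

/-- Arrowhead constant letter (Sum coordinates). [folklore] -/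
def Aflat : Matrix (Fin k ⊕ Fin 1) (Fin k ⊕ Fin 1) ℝ :=
  Matrix.fromBlocks (diagonal fun l => -(d.β l * ν l)) (replicateCol (Fin 1) (cvec ν z s d))
    (replicateRow (Fin 1) (cvec ν z s d)) (Matrix.of fun _ _ => ηnew s d * lconst ν z)

/-- Arrowhead linear letter (Sum coordinates). [folklore] -/
def Bflat : Matrix (Fin k ⊕ Fin 1) (Fin k ⊕ Fin 1) ℝ :=
  Matrix.fromBlocks (diagonal d.β) 0 0 (Matrix.of fun _ _ => ηnew s d * lslope ν z)

/-- Kernel vector at the parent root `z_i`. [folklore] -/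
def kvec (i : Fin (k + 1)) : Fin k ⊕ Fin 1 → ℝ :=
  Sum.elim (fun l => -(cvec ν z s d l) / (d.β l * (z i - ν l))) (fun _ => 1)

/-- Matrix of kernel vectors (Sum rows). [folklore] -/
def Vflat : Matrix (Fin k ⊕ Fin 1) (Fin (k + 1)) ℝ := Matrix.of fun p i => kvec ν z s d i p

/-- Matrix of kernel vectors, rows on `Fin (k+1)`. [folklore] -/
def Vsq : Matrix (Fin (k + 1)) (Fin (k + 1)) ℝ := (Vflat ν z s d).submatrix finSumFinEquiv.symm id

/-- THE GENERAL BORDERING STEP. [folklore] -/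
def step : TowerData (k + 1) where
  A := Matrix.reindex finSumFinEquiv finSumFinEquiv
    (Matrix.fromBlocks d.A (replicateCol (Fin 1) (bvec ν z s d)) (replicateRow (Fin 1) (bvec ν z s d))
      (Matrix.of fun _ _ => ηnew s d * lconst ν z))
  B := Matrix.reindex finSumFinEquiv finSumFinEquiv
    (Matrix.fromBlocks d.B 0 0 (Matrix.of fun _ _ => ηnew s d * lslope ν z))
  U := extendOne d.U * Matrix.reindex finSumFinEquiv finSumFinEquiv (Bflat ν z s d) * Vsq ν z s d *
    diagonal (fun i => (βnew ν z s d i)⁻¹)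
  W := extendOne d.W * Vsq ν z s d
  β := βnew ν z s d
  θ := θnew s d

end Step

end Gen

/-! ## The mirror tower -/

/-- Root vector of the mirror level `k` for size `m`: the first `k` points of window `2m − k`. [folklore] -/
def mroot (m k : ℕ) (i : Fin k) : ℝ := zwin (2 * m - k) i

/-- THE MIRROR TOWER for size `m`: level `k+1` is obtained from level `k` by the general step with parent roots ABOVE the child's
(`s = −1`); level `k` has roots `mroot m k`. [folklore] -/
def mtower (m : ℕ) : (k : ℕ) → TowerData k
  | 0 => towerZero
  | k + 1 => Gen.step (mroot m k) (mroot m (k + 1)) (-1) (mtower m k)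

/-! ## Congruence between the two top levels -/

/-- `ε = θ₁ θ₂`, the relative orientation of the two top levels. [folklore] -/
def congEps (m : ℕ) : ℝ := (tower m).θ * (mtower m m).θ

/-- Diagonal rescaling `S = diagonal √(ε β₁/β₂)`. [folklore] -/
def congS (m : ℕ) : Matrix (Fin m) (Fin m) ℝ :=
  diagonal fun i => Real.sqrt (congEps m * (tower m).β i / (mtower m m).β i)

/-- Its inverse `S⁻¹ = diagonal (1/√(ε β₁/β₂))`. [folklore] -/
def congSinv (m : ℕ) : Matrix (Fin m) (Fin m) ℝ :=
  diagonal fun i => (Real.sqrt (congEps m * (tower m).β i / (mtower m m).β i))⁻¹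

/-- The congruence `C = W₂ S U₁ᵀ` with `A₁ + xB₁ = Cᵀ (ε (A₂ + xB₂)) C`. [folklore] -/
def congC (m : ℕ) : Matrix (Fin m) (Fin m) ℝ := (mtower m m).W * congS m * ((tower m).U)ᵀ

/-- Its inverse `C⁻¹ = W₁ S⁻¹ U₂ᵀ`. [folklore] -/
def congCinv (m : ℕ) : Matrix (Fin m) (Fin m) ℝ := (tower m).W * congSinv m * ((mtower m m).U)ᵀ

/-! ## The downward flag and the two-sided witness -/

/-- Threshold of downward coordinate `a` (size `m`): `thr (2m − a − 1) = 3·4^{-(2m−a)}`, between windows `2m − a` and `2m − a − 1`. [folklore] -/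
def thrDn (m a : ℕ) : ℝ := thr (2 * m - a - 1)

/-- Sign of downward coordinate `a`: `−(p₂_a(top point of its window) · p₂_{a+1}(bottom point of the window above))`, read on the mirror levels. [folklore] -/
def sgnDn (m a : ℕ) : ℝ :=
  -(Matrix.det ((mtower m a).A + spt (2 * m - a) a • (mtower m a).B) *
    Matrix.det ((mtower m (a + 1)).A + spt (2 * m - a - 1) 0 • (mtower m (a + 1)).B))

/-- The downward flag letter at lacunarity `D`, transported into the coordinates of `tower m`:
`Cᵀ (ε · diagonal (sgnDn a · thrDn a ^ D)) C`. [folklore] -/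
def dnLetter (m D : ℕ) : Matrix (Fin m) (Fin m) ℝ :=
  (congC m)ᵀ * (congEps m • diagonal fun a : Fin m => sgnDn m a * thrDn m a ^ D) * congC m

/-- The upward flag letter at lacunarity `D+1`: `diagonal (sgn a · thr a ^ (−(D+1)))`. [folklore] -/
def upLetter (m D : ℕ) : Matrix (Fin m) (Fin m) ℝ :=
  diagonal fun a : Fin m => sgn a * ((thr a)⁻¹) ^ (D + 1)

/-- The two-sided witness letters on the support `(0, D, D+1, 2D+1)`: `(dnLetter, A_m, B_m, upLetter)`. [folklore] -/
def witness4Letters (m D : ℕ) : Fin 4 → Matrix (Fin m) (Fin m) ℝ :=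
  ![dnLetter m D, (tower m).A, (tower m).B, upLetter m D]

/-- The two-sided witness support `(0, D, D+1, 2D+1)`. [folklore] -/
def witness4Exps (D : ℕ) : Fin 4 → ℕ := ![0, D, D + 1, 2 * D + 1]

/-- The normalised witness at a point: `t^{-D} · F_D(t) = A + tB + diagonal(up) + dnLetter(t)`. [folklore] -/
def Gmat (m D : ℕ) (t : ℝ) : Matrix (Fin m) (Fin m) ℝ :=
  (tower m).A + t • (tower m).B + diagonal (fun a : Fin m => sgn a * (t / thr a) ^ (D + 1)) +
    (congC m)ᵀ * (congEps m • diagonal fun a : Fin m => sgnDn m a * (thrDn m a / t) ^ D) * congC m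

/-! ## The extended test-point walk: `tri m` downward points, then the `tri (m+1)` upward points -/

/-- The downward walk: state `(j, r)` = test point `r` of the mirror level `j` (window `2m − j`), from `(0,0)` upward in `t`. [folklore] -/
def dwalk : ℕ → ℕ × ℕ
  | 0 => (0, 0)
  | n + 1 => if (dwalk n).2 < (dwalk n).1 then ((dwalk n).1, (dwalk n).2 + 1) else ((dwalk n).1 + 1, 0)

/-- The `n`-th test point of the two-sided witness of size `m` (`(m+1)²` points, increasing). [folklore] -/
def cpts (m n : ℕ) : ℝ :=
  if n < tri m then spt (2 * m - (dwalk n).1) (dwalk n).2 else pts m (n - tri m)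

/-- Product of the downward signs ON throughout the mirror level `j` (coordinates `a ≥ j`). [folklore] -/
def levelSignDn (m j : ℕ) : ℝ := ∏ a ∈ univ.filter (fun a : Fin m => j ≤ (a : ℕ)), sgnDn m a

/-- The limiting sign datum at the `n`-th test point of the two-sided witness. [folklore] -/
def Ecomb (m n : ℕ) : ℝ :=
  if n < tri m then
    congEps m ^ m * levelSignDn m (dwalk n).1 *
      Matrix.det ((mtower m (dwalk n).1).A + cpts m n • (mtower m (dwalk n).1).B)
  else Ewalk m (n - tri m)

end Summit.ValiantsHypothesis.ValiantsHypothesis.Theorems.LacunarySymmetroidMatrixDescartes.Census.LagrangeTower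

end
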